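import Literature.NumberTheory.Automorphic.LangAutomorphicFormsAdmissibleProofs
import Literature.NumberTheory.Automorphic.HarishChandraFinitenessGLOne
import HarnessLib

/-!
# Automorphic representations of `GL₁(𝔸_K)` are admissible (Borel–Jacquet 1979, 4.5, case `n = 1`)

Topic `NumberTheory/Automorphic`; sibling proof file of `LangAutomorphicForms` (theorems only: no
definition, no named fact). The named fact `automorphicRep_isAdmissible hcpt` of `LangAutomorphicForms`
(Borel–Jacquet 1979, 4.5–4.6: every automorphic representation `π = W / W'` of `GL_n(𝔸_K)` is a smooth
`GL_n(𝔸_K^∞)`-module whose `U`-invariants `(W / W')^U` are admissible `K_∞`-modules, for every level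
`U`) was reduced in `LangAutomorphicFormsAdmissibleProofs` to Harish-Chandra's finiteness theorem
(`automorphicRep_isAdmissible_of_harishChandra_finiteness`, Borel–Jacquet 4.3 (i) ⇒ 4.5), and
Harish-Chandra's finiteness theorem is proved in the tree for `n = 1`
(`harishChandra_finiteness_glOne`, `HarishChandraFinitenessGLOne`). This file records the composite:

* `automorphicRep_isAdmissible_glOne` — **Borel–Jacquet 4.5 for `GL₁` over a number field, proved**:
  `automorphicRep_isAdmissible (n := 1) hcpt`, i.e. every automorphic representation of the idèle
  group `𝔸_K^× = GL₁(𝔸_K)` in the sense of Borel–Jacquet 4.6 (an irreducible subquotient `W / W'` of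
  the space of automorphic forms) is smooth at the finite places and `(W / W')^U` has finite
  `K_∞`-multiplicities for every level `U`.
* `AutomorphicRepData.exists_hasLocalComponentAt_glOne` — hence (Flath, Corvallis 1979, Thm. 3–4, via
  the tree's reduction `AutomorphicRepData.exists_hasLocalComponentAt_of_isAdmissible` of
  `LocalComponentBJExistsProofs`) every automorphic representation of `GL₁(𝔸_K)` has a local
  component at every finite place: the named fact `AutomorphicRepData.exists_hasLocalComponentAt 1 K hcpt`
  holds.

The general case (`n ≥ 2`) of both statements waits only on the discharge of
`harishChandra_finiteness_gl hcpt` / `harishChandra_finiteness hcpt` (reduction theory and constant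
terms), exactly as in print ("4.5 … follows from 4.3 (i)").

## References

* A. Borel, H. Jacquet, *Automorphic forms and automorphic representations*, Proc. Sympos. Pure
  Math. 33 (Corvallis 1977), Part 1 (1979), 189–202, 4.3 (i), 4.5, 4.6 [BorelJacquet1979]
  (doi:10.1090/pspum/033.1/546598).
* D. Flath, *Decomposition of representations into tensor products*, Proc. Sympos. Pure Math. 33,
  Part 1 (1979), 179–183, Thm. 3 and Thm. 4 [FlathCorvallis1979].
* Harish-Chandra, *Automorphic forms on semisimple Lie groups*, LNM 62 (1968), Thm. 1.
-/

open scoped MatrixGroups Matrix Classical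
open NumberField IsDedekindDomain

noncomputable section

namespace Literature.NumberTheory.Automorphic

variable {K : Type} [Field K] [NumberField K]

/-- **Automorphic representations of `GL₁(𝔸_K)` are admissible** (Borel–Jacquet 1979, 4.5 and 4.6,
case `n = 1`, proved): for every automorphic representation datum `π = W / W'` on `GL₁(𝔸_K)` the
action of `GL₁(𝔸_K^∞)` on `W / W'` is smooth and, for every level `U`, the `K_∞`-module `(W / W')^U`
is admissible. This is the named fact `automorphicRep_isAdmissible hcpt` of `LangAutomorphicForms` at
`n = 1`, obtained from Harish-Chandra's finiteness theorem for `GL₁`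
(`harishChandra_finiteness_glOne`) through the tree's proof of "4.3 (i) ⇒ 4.5"
(`automorphicRep_isAdmissible_of_harishChandra_finiteness`). [cite: BorelJacquet1979, 4.5] -/
theorem automorphicRep_isAdmissible_glOne (hcpt : isCompact_glFiniteIntegralLevel 1 K) :
    automorphicRep_isAdmissible (n := 1) hcpt :=
  automorphicRep_isAdmissible_of_harishChandra_finiteness (harishChandra_finiteness_glOne hcpt)

/-- **Local components of automorphic representations of `GL₁(𝔸_K)` exist** (Flath, Corvallis 1979,
Thm. 3 and Thm. 4; Borel–Jacquet 1979, 4.6), proved: the named fact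
`AutomorphicRepData.exists_hasLocalComponentAt 1 K hcpt` — for every automorphic representation
`π = W / W'` of `GL₁(𝔸_K)` and every finite place `v`, the restriction of `W / W'` to `GL₁(K_v)`
contains an irreducible smooth `GL₁(K_v)`-stable subspace — holds, by the tree's reduction
`AutomorphicRepData.exists_hasLocalComponentAt_of_isAdmissible` to admissibility and
`automorphicRep_isAdmissible_glOne`. [cite: FlathCorvallis1979, Thm. 3 and Thm. 4] -/
theorem AutomorphicRepData.exists_hasLocalComponentAt_glOne (hcpt : isCompact_glFiniteIntegralLevel 1 K) :
    AutomorphicRepData.exists_hasLocalComponentAt 1 K hcpt :=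
  AutomorphicRepData.exists_hasLocalComponentAt_of_isAdmissible (automorphicRep_isAdmissible_glOne hcpt)

end Literature.NumberTheory.Automorphic
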